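import Literature.NumberTheory.EllipticCurves.BurungaleSkinnerTianWan2024.OrdinaryMainStatementTwistOfSkinnerUrbanProofs
import HarnessLib

/-!
# Burungale–Skinner–Tian–Wan (arXiv:2409.01350v2, PREPRINT): the `p`-converse (Thm. 12.3-shape) and
# the rank-one `p`-part of BSD (Thm. 11.12-shape) for SEMISTABLE curves at a good ORDINARY `p ≠ 2`,
# with BOTH Thm. 10.10 (a) binders DISCHARGED from Skinner–Urban — ONE preprint binder left each

A `…Proofs` companion (theorems only: no definition, no named fact, no instance, no `sorry`) of
`OrdinaryMainStatementSemistableOPEN.lean` (the typer's corollaries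
`analyticRank_eq_one_of_prop121_ordinary_OPEN_of_thm1010_OPEN_of_selmerCorank_eq_one` and
`bsdp_rankOne_of_prop1111_OPEN_of_thm1010_OPEN`, each granted THREE preprint binders: `h121` resp.
`h1111`, and the two Thm. 10.10 (a) binders `thm1010a_mainStatement_semistable_ordinary_OPEN` (O1),
`thm1010_twist_mainStatement_OPEN` (O2)) and of ARM P's
`OrdinaryMainStatementSemistableOfSkinnerUrbanProofs.lean` / `OrdinaryMainStatementTwistOfSkinnerUrbanProofs.lean`
(bsd-cited-r03, p503679 / p504869: O1 and O2 BY NAME from the Skinner–Urban main conjecture `hSU` —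
refereed [SU14] Thm. 3.29 at `p ≥ 5`, PUB\* at `p = 3` — with the Greenberg–Vatsal period unit (`h5`,
`h3`), modularity (`hmod`) and Diamond's refined Serre conjecture (`hLL`, for Ribet's (ram) prime of a
semistable curve with `E[p]` irreducible)).

Composing the two gives the corollaries with their Thm-10.10 binders discharged, so that the ONLY
PREPRINT input left is ONE announced statement of the paper each:

* `pConverse_semistable_of_prop121_OPEN_of_skinnerUrban` : for `W/ℚ` globally minimal and SEMISTABLE,
  `p ≠ 2` of good ordinary reduction, `E[p]` irreducible: `corank_{ℤ_p} Sel_{p^∞}(E/ℚ) = 1 ∧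
  #Ш(E/ℚ)[p^∞] < ∞ ⟹ ord_{s=1} L(E,s) = 1`, granted `h121` (BSTW Prop. 12.1, ordinary — PREPRINT binder)
  + `hSU` + `h5`/`h3` + `hmod` + `hLL` + `p`-parity + Friedberg–Hoffstein + Kato 14.2 + entire `L(E,s)`;
* `bsdp_rankOne_semistable_of_prop1111_OPEN_of_skinnerUrban` : for the same curves with
  `ord_{s=1} L(E,s) = 1`, a Heegner field `K` (`p` split, (Heeg), `L'(E/K,1) ≠ 0`) and any globally
  minimal model `W'` of `E^{(d_K)}`: Miller's `BSD(E,p)`, granted `h1111` (BSTW Prop. 11.11, ordinary —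
  PREPRINT binder) + `hSU` + `h5`/`h3` + `hmodF` + `hLL` + entire `L` + GZK.

Both terms are bsd-cited-r03's K7/K8 (D-AUDIT R-01 NOTE-3 ADDENDUM-1,
`pub/bsd-cited/sheets/r03-R01-note3/d_audit_r03_R01note3_add1_check.lean` sha16 75e0b43e700556c7,
farm rc 0), landed here by the paper's typer so that consumers can cite them BY NAME.

HONEST FRAMING: typed ≠ proved ≠ endorsed. `h121` / `h1111` are explicitly labelled OPEN binders of an
UNREFEREED preprint ([claim: BurungaleSkinnerTianWan2024, status: under-review]); `hSU` at `p = 3` is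
PUB\* ([SU14] print `p ≥ 5`; the `p = 3` extension is Wan's remark, cell-refereed reading); nothing here
proves BSD or a main conjecture. No new definition, no new named fact (net debt 0).

## References
* [BurungaleSkinnerTianWan2024] A. Burungale, C. Skinner, Y. Tian, X. Wan, *Zeta elements for elliptic
  curves and applications*, arXiv:2409.01350v2 (PREPRINT): Thm. 10.10 (a) (p. 89), Prop. 11.11
  (pp. 94–95), Thm. 11.12 (p. 95), Prop. 12.1 (p. 95), Thm. 12.3 (p. 96, proof tex l.8165–8177).
* [SkinnerUrban2014] C. Skinner, E. Urban, *The Iwasawa main conjectures for GL₂*, Invent. math. 195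
  (2014), Thm. 3.29 (tree: `skinner_urban_main_conjecture`).
* [Miller2011LMS] R. L. Miller, *Proving the Birch and Swinnerton-Dyer conjecture for specific elliptic
  curves of analytic rank zero and one*, LMS J. Comput. Math. 14 (2011), Def. 1.1 (`BSDp`).
-/

noncomputable section

open scoped Classical

open NumberField CongruenceSubgroup WeierstrassCurve Literature.NumberTheory.EllipticCurves
  Literature.NumberTheory.EllipticCurves.ModularForms Literature.NumberTheory.EllipticCurves.Rank1Residual
  Literature.NumberTheory.EllipticCurves.SkinnerUrban2014 Literature.NumberTheory.Automorphic

namespace Literature.NumberTheory.EllipticCurves.BurungaleSkinnerTianWan2024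

/-- **`p`-converse for SEMISTABLE curves at a good ordinary `p ≠ 2` with `E[p]` irreducible, ONE
preprint binder** (BSTW Prop. 12.1, ordinary: `h121`): `corank_{ℤ_p} Sel_{p^∞}(E/ℚ) = 1 ∧
#Ш(E/ℚ)[p^∞] < ∞ ⟹ ord_{s=1} L(E,s) = 1`. The two Thm. 10.10 (a) binders of
`analyticRank_eq_one_of_prop121_ordinary_OPEN_of_thm1010_OPEN_of_selmerCorank_eq_one` are fed by
`thm1010a_mainStatement_semistable_ordinary_OPEN_of_skinnerUrban` and
`thm1010_twist_mainStatement_OPEN_of_skinnerUrban` (Skinner–Urban `hSU` + Greenberg–Vatsal period unit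
`h5`/`h3` + modularity `hmod` + Diamond's refined Serre `hLL`); the rest is the refereed `p`-parity
theorem, Friedberg–Hoffstein, Kato 14.2 and the entire continuation of `L(E,s)`. A COROLLARY of the
paper's statements in the shape of Thm. 12.3 (whose `p = 3` branch asks (ram)) — not a transcription of
a printed statement; `h121` is PREPRINT, NEVER a theorem. (bsd-cited-r03's K7.)
[claim: BurungaleSkinnerTianWan2024, status: under-review]
[cite: BurungaleSkinnerTianWan2024, Prop. 12.1 (p. 95; OPEN binder), Thm. 10.10 (a) (p. 89) and the proof of Thm. 12.3 (p. 96, tex l.8165–8177) (corollary; not a printed statement)]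
[cite: SkinnerUrban2014, Thm. 3.29] -/
theorem pConverse_semistable_of_prop121_OPEN_of_skinnerUrban
    (h121 : prop121_pConverse_of_charIdealLe_ordinary_OPEN.{0})
    (hSU : ∀ (W : WeierstrassCurve ℚ) [W.IsElliptic] [W.IsGloballyMinimal] (p : ℕ) [Fact p.Prime]
      (κ : ZpExtension ℚ p) (γ : Field.absoluteGaloisGroup ℚ) (N : ℕ) [NeZero N]
      (f : CuspForm (Gamma0 N) 2),
      skinner_urban_main_conjecture W p (κ := κ) (γ := γ) (f := f))
    (h5 : realPeriodRat_eq_unit_mul_plusPeriod) (h3 : realPeriodRat_eq_unit_mul_plusPeriod_three)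
    (hmod : exists_isNewformOf) (hLL : diamond1995_refinedSerre)
    (hpar : ∀ (W : WeierstrassCurve ℚ) [W.IsElliptic] (p : ℕ) [Fact p.Prime], p_parity W p)
    (hFH : friedbergHoffstein_exists_heegnerField_split_twist_ne_zero)
    (hKato : ∀ (W : WeierstrassCurve ℚ) [W.IsElliptic] (p : ℕ) [Fact p.Prime],
      kato_finite_of_L_one_ne_zero W p)
    (hE : hasEntireLFunction_rat)
    (W : WeierstrassCurve ℚ) [W.IsElliptic] [W.IsGloballyMinimal] (p : ℕ) [Fact p.Prime]
    (hp2 : p ≠ 2) (hsst : Semistable W) (hgood : W.HasGoodReductionAtPrime p)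
    (hord : ¬ (p : ℤ) ∣ W.frobeniusTrace p) (hirr : W.HasIrreducibleModPGaloisRep p)
    (hcorank : W.selmerCorank p = 1)
    (hsha : Finite (AddCommGroup.primaryComponent W.sha p)) : W.analyticRank = 1 :=
  analyticRank_eq_one_of_prop121_ordinary_OPEN_of_thm1010_OPEN_of_selmerCorank_eq_one h121
    (thm1010a_mainStatement_semistable_ordinary_OPEN_of_skinnerUrban hSU h5 h3 hmod hLL)
    (thm1010_twist_mainStatement_OPEN_of_skinnerUrban hSU h5 h3 hmod hLL) hpar hFH hKato hE W p hp2
    hsst hgood hord hirr hcorank hsha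

/-- **Rank-one `p`-part of BSD for SEMISTABLE curves at a good ordinary `p ≠ 2` with `E[p]`
irreducible, ONE preprint binder** (BSTW Prop. 11.11, ordinary: `h1111`): for `ord_{s=1} L(E,s) = 1`, a
Heegner field `K` (imaginary quadratic, `p` split, (Heeg) for `N_E`, `L'(E/K,1) ≠ 0` as
`LDerivEK W K ≠ 0`) and ANY globally minimal model `W'` of `E^{(d_K)}`: Miller's `BSD(E,p)`
(`BSDp W p`). The two Thm. 10.10 (a) binders of `bsdp_rankOne_of_prop1111_OPEN_of_thm1010_OPEN` are
fed by `thm1010a_mainStatement_semistable_ordinary_OPEN_of_skinnerUrban` and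
`thm1010_twist_mainStatement_OPEN_of_skinnerUrban` (`hSU`, `h5`, `h3`, `hmodF`, `hLL`); the rest is
the entire continuation `hmod` and GZK `hGZK`. A COROLLARY of the paper's statements in the shape of
Thm. 11.12 (whose ordinary branch asks (ram)) — not a transcription of a printed statement; `h1111` is
PREPRINT, NEVER a theorem. (bsd-cited-r03's K8.)
[claim: BurungaleSkinnerTianWan2024, status: under-review]
[cite: BurungaleSkinnerTianWan2024, Prop. 11.11 (pp. 94–95; OPEN binder), Thm. 10.10 (a) (p. 89) and Thm. 11.12 (p. 95) (corollary; not a printed statement)]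
[cite: SkinnerUrban2014, Thm. 3.29] [cite: Miller2011LMS, Def. 1.1] -/
theorem bsdp_rankOne_semistable_of_prop1111_OPEN_of_skinnerUrban
    (h1111 : prop1111_pPart_rankOne_of_mainStatements_ordinary_OPEN)
    (hSU : ∀ (W : WeierstrassCurve ℚ) [W.IsElliptic] [W.IsGloballyMinimal] (p : ℕ) [Fact p.Prime]
      (κ : ZpExtension ℚ p) (γ : Field.absoluteGaloisGroup ℚ) (N : ℕ) [NeZero N]
      (f : CuspForm (Gamma0 N) 2),
      skinner_urban_main_conjecture W p (κ := κ) (γ := γ) (f := f))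
    (h5 : realPeriodRat_eq_unit_mul_plusPeriod) (h3 : realPeriodRat_eq_unit_mul_plusPeriod_three)
    (hmodF : exists_isNewformOf) (hLL : diamond1995_refinedSerre)
    (hmod : hasEntireLFunction_rat) (hGZK : rank_eq_analyticRank_of_analyticRank_le_one)
    (W W' : WeierstrassCurve ℚ) [W.IsElliptic] [W.IsGloballyMinimal] [W'.IsElliptic]
    [W'.IsGloballyMinimal] (p : ℕ) [Fact p.Prime] (K : Type) [Field K] [NumberField K]
    {C : VariableChange ℚ} (hp2 : p ≠ 2) (hsst : Semistable W) (hgood : W.HasGoodReductionAtPrime p)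
    (hord : ¬ (p : ℤ) ∣ W.frobeniusTrace p) (hirr : W.HasIrreducibleModPGaloisRep p)
    (hr : W.analyticRank = 1) (hK : IsImaginaryQuadratic K)
    (hsplit : ((Ideal.span {(p : ℤ)}).primesOver (𝓞 K)).ncard = 2)
    (hH : SatisfiesHeegnerHypothesis (W.conductorNorm ℤ) K) (hL : LDerivEK W K ≠ 0)
    (hC : C • W' = W.quadraticTwist (NumberField.discr K : ℚ)) : BSDp W p :=
  bsdp_rankOne_of_prop1111_OPEN_of_thm1010_OPEN h1111
    (thm1010a_mainStatement_semistable_ordinary_OPEN_of_skinnerUrban hSU h5 h3 hmodF hLL)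
    (thm1010_twist_mainStatement_OPEN_of_skinnerUrban hSU h5 h3 hmodF hLL) hmod hGZK W W' p K hp2
    hsst hgood hord hirr hr hK hsplit hH hL hC

end Literature.NumberTheory.EllipticCurves.BurungaleSkinnerTianWan2024

end
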